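import Mathlib

/-!
# Class split for rank certificates (crux `ValuativeGCT.ValuativeFlip`, stub `stub_fourRowPencilRank`)

The abstract half of the "class split" PE3(a) of `Cruxes/ValuativeFlip/DECOMPOSITIONS.md` for the
four-row pencil span (hypothesis `H` of `fourRowPencilRank_of_pencilCertificate`): for the cyclic
band pencil the products `y_t · Per_ij(M(y))` are weighted-homogeneous of weight `i - j + t ∈ ℤ/n`
for the weighting `y_s ↦ s`, so the `4n²` products fall into `n` classes with pairwise disjoint
monomial supports and `rank = Σ_q rank_q` (tables: `Cruxes/ValuativeFlip/AxisK2G1PencilRankTables.md`; certificate formats: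
`Theorems/ValuativeGCTValuativeFlipPencilRankCertificates.lean`).
What a prover needs from this is the direction "per-class certificates combine":

* `prc_linearIndependent_of_classes` — if linear projections `π a` fix the members of class `a`
  and kill the members of every other class, then independence class by class gives independence
  of the whole family;
* `prc_linearIndependent_of_weightedClasses` — the instance `π a = weightedHomogeneousComponent w a`
  for weighted-homogeneous polynomials (any additive weight monoid, e.g. `ZMod n`);
* `prc_card_le_finrank_span_of_weightedClasses` — the finrank form for a sub-family, in the shape of
  `H`'s conclusion `card κ ≤ finrank (span (range f))`.

[folklore; Mathlib `MvPolynomial.weightedHomogeneousComponent`]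
-/

set_option linter.dupNamespace false

namespace Summit.ValiantsHypothesis.ValiantsHypothesis.Theorems.ValuativeFlip

open scoped BigOperators

/-- **Per-class independence combines.**  Let `cls : ι → A` sort a family `f` into classes and let
`π a` be linear maps with `π (cls i) (f i) = f i` and `π a (f i) = 0` for `a ≠ cls i` (projections onto
independent pieces).  If each class `{i // cls i = a}` is linearly independent then so is `f`:
project a relation onto the class of any index. [folklore] -/
theorem prc_linearIndependent_of_classes {R V A ι : Type*} [CommRing R] [AddCommGroup V]
    [Module R V] (π : A → V →ₗ[R] V) (cls : ι → A) (f : ι → V)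
    (hsame : ∀ i, π (cls i) (f i) = f i) (hne : ∀ i a, a ≠ cls i → π a (f i) = 0)
    (h : ∀ a, LinearIndependent R fun i : {i // cls i = a} => f i) : LinearIndependent R f := by
  classical
  rw [linearIndependent_iff']
  intro s g hg i hi
  set a := cls i with ha
  -- project the relation onto class `a`
  have hproj := congrArg (π a) hg
  rw [map_sum, map_zero] at hproj
  have hsum : ∑ x ∈ s.filter (fun x => cls x = a), g x • f x = 0 := by
    have hx : ∀ x ∈ s, π a (g x • f x) = if cls x = a then g x • f x else 0 := by
      intro x _
      rw [map_smul]
      split_ifs with hx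
      · rw [← hx, hsame x]
      · rw [hne x a (fun h' => hx h'.symm), smul_zero]
    rw [Finset.sum_filter, ← Finset.sum_congr rfl hx]
    exact hproj
  -- independence of class `a`, on the finset `s.filter (cls · = a)` viewed in the subtype
  have hli := (linearIndependent_iff'.mp (h a)) ((s.filter fun x => cls x = a).subtype fun x => cls x = a)
    (fun x => g x) ?_ ⟨i, rfl⟩ ?_
  · exact hli
  · have hmap : ((s.filter fun x => cls x = a).subtype fun x => cls x = a).map
        (Function.Embedding.subtype fun x => cls x = a) = s.filter fun x => cls x = a := by
      ext x
      simp only [Finset.mem_map, Finset.mem_subtype, Function.Embedding.subtype_apply,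
        Finset.mem_filter]
      constructor
      · rintro ⟨y, hy, rfl⟩
        exact hy
      · intro hx
        exact ⟨⟨x, hx.2⟩, hx, rfl⟩
    have hs := Finset.sum_map ((s.filter fun x => cls x = a).subtype fun x => cls x = a)
      (Function.Embedding.subtype fun x => cls x = a) (fun x => g x • f x)
    rw [hmap] at hs
    simp only [Function.Embedding.subtype_apply] at hs
    rw [← hs]
    exact hsum
  · rw [Finset.mem_subtype]
    exact Finset.mem_filter.mpr ⟨hi, rfl⟩

/-- **Weighted class split.**  Polynomials that are weighted-homogeneous (weights `w : σ → A` in any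
additive commutative monoid, e.g. `A = ZMod n` for the cyclic band pencil) are linearly independent
as soon as each weight class is: the projections are the weighted homogeneous components.
[folklore; Mathlib `IsWeightedHomogeneous.weightedHomogeneousComponent_same/_ne`] -/
theorem prc_linearIndependent_of_weightedClasses {R σ A ι : Type*} [CommRing R] [AddCommMonoid A]
    (w : σ → A) (cls : ι → A) (f : ι → MvPolynomial σ R)
    (hf : ∀ i, MvPolynomial.IsWeightedHomogeneous w (f i) (cls i))
    (h : ∀ a, LinearIndependent R fun i : {i // cls i = a} => f i) : LinearIndependent R f :=
  prc_linearIndependent_of_classes (fun a => MvPolynomial.weightedHomogeneousComponent w a) cls f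
    (fun i => (hf i).weightedHomogeneousComponent_same)
    (fun i a hai => (hf i).weightedHomogeneousComponent_ne a hai) h

/-- **Weighted class split, finrank form** (shape of hypothesis `H`): for a finite family `f` of
polynomials and a sub-family `f ∘ e` whose members are weighted-homogeneous of weights `cls b`, if
each weight class of the sub-family is linearly independent then `card κ ≤ finrank (span (range f))`.
So per-class certificates (coefficient minors, triangular, tight minors — file
`…PencilRankCertificates.lean`) simply ADD UP. [folklore] -/
theorem prc_card_le_finrank_span_of_weightedClasses {K σ A ι κ : Type*} [Field K] [Fintype ι]
    [Fintype κ] [AddCommMonoid A] (w : σ → A) (f : ι → MvPolynomial σ K) (e : κ → ι) (cls : κ → A)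
    (hf : ∀ b, MvPolynomial.IsWeightedHomogeneous w (f (e b)) (cls b))
    (h : ∀ a, LinearIndependent K fun b : {b // cls b = a} => f (e b)) :
    Fintype.card κ ≤ Module.finrank K ↥(Submodule.span K (Set.range f)) := by
  have h1 : Fintype.card κ ≤ Module.finrank K ↥(Submodule.span K (Set.range (f ∘ e))) :=
    linearIndependent_iff_card_le_finrank_span.mp
      (prc_linearIndependent_of_weightedClasses w cls (f ∘ e) hf h)
  haveI : Module.Finite K ↥(Submodule.span K (Set.range f)) :=
    Module.Finite.span_of_finite K (Set.finite_range f)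
  exact h1.trans (Submodule.finrank_mono (Submodule.span_mono (Set.range_comp_subset_range e f)))

end Summit.ValiantsHypothesis.ValiantsHypothesis.Theorems.ValuativeFlip
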